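import Literature.Combinatorics.SimpleGraph.HamiltonianGadgetSubstitutionCount
import HarnessLib

/-!
# Gadget substitution for Hamiltonian-path counts, XI: certifying one- and two-slot gadgets by Hamiltonian-path counts

The hypotheses of the local-replacement theorem (`HamiltonianGadgetSubstitution*.lean`) for a
concrete gadget are its **exclusivity** (`Exclusive`) and its **census** (`coverCount`), both
statements about families of port-to-port strands. For gadgets whose strands are not forced by
degree-two vertices — the ladders of Garey–Johnson–Tarjan whose rungs carry two-node cycles, used
to cross exclusive-or lines (Liśkiewicz–Ogihara–Toda 2003, §3, Fig. 2 (b)) — the forced-walk checks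
of `HamiltonianRailGadget.lean` do not apply. This file reduces both hypotheses, for gadgets with
at most two slots, to numbers of Hamiltonian paths of small explicit graphs, which the verified
enumerator of `HamiltonianPathEnumeration.lean` evaluates in the kernel:

* `coverCount_singleton_eq_hamCount` — the covers realising one slot `(a, b)` are the Hamiltonian
  `a`–`b` paths of the gadget through `VX ∪ {a, b}`;
* `coverCount_empty_eq_zero` — a nonempty gadget has no cover realising no slot;
* `isHamPathOn_two_strands` — two disjoint strands `p ⇝ q`, `p' ⇝ q'` covering the gadget glue,
  through one extra **connector edge** `q p'`, to a Hamiltonian `p`–`q'` path of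
  `GX ⊔ edge q p'`; hence
* `coverCount_pair_eq_zero_of_hamCount_eq_zero` — if `GX ⊔ edge e₂ f₁` has no Hamiltonian
  `e₁`–`f₂` path then no cover realises both slots `e = (e₁, e₂)`, `f = (f₁, f₂)`;
* **`exclusive_pair_of_hamCount_eq_zero`** — a two-slot gadget is exclusive as soon as the four
  "wrong" port pairs admit no Hamiltonian path of the gadget and the two connector graphs
  `GX ⊔ edge e₂ f₁` (from `e₁` to `f₂`) and `GX ⊔ edge e₂ f₂` (from `e₁` to `f₁`) admit none.

## References

* M. R. Garey, D. S. Johnson, *Computers and Intractability*, Freeman 1979, §3.2.2.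
* M. R. Garey, D. S. Johnson, R. E. Tarjan, SIAM J. Comput. 5 (1976) 704–714 (crossing of
  exclusive-or lines).
* M. Liśkiewicz, M. Ogihara, S. Toda, TCS 304 (2003) 129–156, §3, Fig. 2 (b).
-/

namespace Literature.Combinatorics.SimpleGraph

open scoped Classical

variable {α : Type*} [DecidableEq α] {GX : _root_.SimpleGraph α} {VX : Finset α}

/-! ### Strands as Hamiltonian paths -/

omit [DecidableEq α] in
/-- A nonempty set of Hamiltonian paths has positive count. [folklore] -/
theorem hamCount_pos_of_isHamPathOn {G : _root_.SimpleGraph α} {W : Finset α} {s t : α} {l : List α}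
    [DecidableEq α] (h : IsHamPathOn G W s t l) : 0 < hamCount G W s t := by
  rw [hamCount_eq, hamCountRF]
  exact (Set.ncard_pos (hamSetRF_finite G W s t ∅ ∅)).2 ⟨l, h, by simp, by simp⟩

omit [DecidableEq α] in
/-- The last entry of `p, xs, q`. [folklore] -/
theorem getLast?_cons_append_singleton (p q : α) (xs : List α) : (p :: (xs ++ [q])).getLast? = some q := by
  rw [← List.cons_append, List.getLast?_append_of_ne_nil _ (List.cons_ne_nil q [])]
  rfl

omit [DecidableEq α] in
/-- A list from `a` to `b ≠ a` is `a, L, b`. [folklore] -/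
theorem exists_eq_cons_append_of_head?_getLast? {l : List α} {a b : α} (hh : l.head? = some a)
    (hl : l.getLast? = some b) (hab : a ≠ b) : ∃ L, l = a :: (L ++ [b]) := by
  rcases l with _ | ⟨x, m⟩
  · simp at hh
  · simp only [List.head?_cons, Option.some.injEq] at hh
    subst hh
    have hm : m ≠ [] := by
      rintro rfl
      simp only [List.getLast?_singleton, Option.some.injEq] at hl
      exact hab hl
    refine ⟨m.dropLast, ?_⟩
    have h1 : m.dropLast ++ [m.getLast hm] = m := List.dropLast_append_getLast hm
    have h2 : (x :: m).getLast? = some (m.getLast hm) := by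
      rw [List.getLast?_eq_some_getLast (List.cons_ne_nil x m), List.getLast_cons hm]
    rw [h2, Option.some.injEq] at hl
    rw [hl] at h1
    rw [h1]

/-- **A strand covering the gadget is a Hamiltonian path** through `VX ∪ {p, q}`. [folklore] -/
theorem isHamPathOn_strand {p q : α} {xs : List α} (hxs : IsStrand GX VX p q xs)
    (hcov : ∀ x ∈ VX, x ∈ xs) (hp : p ∉ VX) (hq : q ∉ VX) (hpq : p ≠ q)
    {W : Finset α} (hW : ∀ x, x ∈ W ↔ x = p ∨ x = q ∨ x ∈ VX) :
    IsHamPathOn GX W p q (p :: (xs ++ [q])) := by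
  obtain ⟨-, hsub, hnd, hch⟩ := hxs
  refine ⟨?_, ?_, rfl, getLast?_cons_append_singleton p q xs, hch⟩
  · rw [List.nodup_cons, List.mem_append, List.mem_singleton, not_or]
    refine ⟨⟨fun h => hp (hsub p h), hpq⟩, List.Nodup.append hnd (List.nodup_singleton q) fun x hx hx' => ?_⟩
    rw [List.mem_singleton] at hx'
    exact hq (hx' ▸ hsub x hx)
  · ext x
    simp only [List.toFinset_cons, List.toFinset_append, Finset.mem_insert, Finset.mem_union, List.mem_toFinset,
      List.toFinset_nil, insert_empty_eq, Finset.mem_singleton, hW]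
    constructor
    · rintro (rfl | h | rfl)
      · exact Or.inl rfl
      · exact Or.inr (Or.inr (hsub x h))
      · exact Or.inr (Or.inl rfl)
    · rintro (rfl | rfl | h)
      · exact Or.inl rfl
      · exact Or.inr (Or.inr rfl)
      · exact Or.inr (Or.inl (hcov x h))

/-- **Two disjoint strands covering the gadget, glued through a connector edge `q p'`, form a
Hamiltonian `p`–`q'` path of `GX ⊔ edge q p'`** through `VX ∪ {p, q, p', q'}`. [folklore] -/
theorem isHamPathOn_two_strands {p q p' q' : α} {xs ys : List α}
    (hxs : IsStrand GX VX p q xs) (hys : IsStrand GX VX p' q' ys) (hdis : List.Disjoint xs ys)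
    (hcov : ∀ x ∈ VX, x ∈ xs ∨ x ∈ ys)
    (hp : p ∉ VX) (hq : q ∉ VX) (hp' : p' ∉ VX) (hq' : q' ∉ VX)
    (hpq : p ≠ q) (hpp' : p ≠ p') (hpq' : p ≠ q') (hqp' : q ≠ p') (hqq' : q ≠ q') (hp'q' : p' ≠ q')
    {W : Finset α} (hW : ∀ x, x ∈ W ↔ x = p ∨ x = q ∨ x = p' ∨ x = q' ∨ x ∈ VX) :
    IsHamPathOn (GX ⊔ _root_.SimpleGraph.fromEdgeSet {s(q, p')}) W p q'
      (p :: (xs ++ q :: p' :: (ys ++ [q']))) := by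
  obtain ⟨hne1, hsub1, hnd1, hch1⟩ := hxs
  obtain ⟨hne2, hsub2, hnd2, hch2⟩ := hys
  refine ⟨?_, ?_, rfl, ?_, ?_⟩
  · -- distinct entries
    have hp_xs : p ∉ xs := fun h => hp (hsub1 p h)
    have hp_ys : p ∉ ys := fun h => hp (hsub2 p h)
    have hq_xs : q ∉ xs := fun h => hq (hsub1 q h)
    have hq_ys : q ∉ ys := fun h => hq (hsub2 q h)
    have hp'_xs : p' ∉ xs := fun h => hp' (hsub1 p' h)
    have hp'_ys : p' ∉ ys := fun h => hp' (hsub2 p' h)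
    have hq'_xs : q' ∉ xs := fun h => hq' (hsub1 q' h)
    have hq'_ys : q' ∉ ys := fun h => hq' (hsub2 q' h)
    have hnd3 : (ys ++ [q']).Nodup := by
      refine List.Nodup.append hnd2 (List.nodup_singleton _) fun x hx hx' => ?_
      rw [List.mem_singleton] at hx'; exact hq'_ys (hx' ▸ hx)
    have hnd4 : (p' :: (ys ++ [q'])).Nodup := by
      rw [List.nodup_cons]
      refine ⟨?_, hnd3⟩
      simp [hp'_ys, hp'q']
    have hnd5 : (q :: p' :: (ys ++ [q'])).Nodup := by
      rw [List.nodup_cons]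
      refine ⟨?_, hnd4⟩
      simp [hq_ys, hqp', hqq']
    have hnd6 : (xs ++ q :: p' :: (ys ++ [q'])).Nodup := by
      refine List.Nodup.append hnd1 hnd5 fun x hx hx' => ?_
      simp only [List.mem_cons, List.mem_append, List.mem_nil_iff, or_false] at hx'
      rcases hx' with rfl | rfl | h | rfl
      · exact hq_xs hx
      · exact hp'_xs hx
      · exact hdis hx h
      · exact hq'_xs hx
    rw [List.nodup_cons]
    refine ⟨?_, hnd6⟩
    simp only [List.mem_append, List.mem_cons, List.mem_nil_iff, or_false, not_or]
    exact ⟨hp_xs, hpq, hpp', hp_ys, hpq'⟩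
  · -- support
    ext x
    simp only [List.toFinset_cons, List.toFinset_append, Finset.mem_insert, Finset.mem_union, List.mem_toFinset,
      List.toFinset_nil, insert_empty_eq, Finset.mem_singleton, hW]
    constructor
    · rintro (rfl | h | rfl | rfl | h | rfl)
      · exact Or.inl rfl
      · exact Or.inr (Or.inr (Or.inr (Or.inr (hsub1 x h))))
      · exact Or.inr (Or.inl rfl)
      · exact Or.inr (Or.inr (Or.inl rfl))
      · exact Or.inr (Or.inr (Or.inr (Or.inr (hsub2 x h))))
      · exact Or.inr (Or.inr (Or.inr (Or.inl rfl)))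
    · rintro (rfl | rfl | rfl | rfl | h)
      · exact Or.inl rfl
      · exact Or.inr (Or.inr (Or.inl rfl))
      · exact Or.inr (Or.inr (Or.inr (Or.inl rfl)))
      · exact Or.inr (Or.inr (Or.inr (Or.inr (Or.inr rfl))))
      · rcases hcov x h with h | h
        · exact Or.inr (Or.inl h)
        · exact Or.inr (Or.inr (Or.inr (Or.inr (Or.inl h))))
  · -- last entry
    have : p :: (xs ++ q :: p' :: (ys ++ [q'])) = (p :: (xs ++ [q, p'] ++ ys)) ++ [q'] := by simp
    rw [this, List.getLast?_append_of_ne_nil _ (List.cons_ne_nil _ _)]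
    rfl
  · -- consecutive entries adjacent
    have hmono : ∀ {l : List α}, List.IsChain GX.Adj l →
        List.IsChain (GX ⊔ _root_.SimpleGraph.fromEdgeSet {s(q, p')}).Adj l :=
      fun h => h.imp fun a b hab => Or.inl hab
    have hc1 : List.IsChain (GX ⊔ _root_.SimpleGraph.fromEdgeSet {s(q, p')}).Adj (p :: (xs ++ [q])) := hmono hch1
    have hc2 : List.IsChain (GX ⊔ _root_.SimpleGraph.fromEdgeSet {s(q, p')}).Adj (q :: p' :: (ys ++ [q'])) := by
      refine List.IsChain.cons_cons (Or.inr ?_) (hmono hch2)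
      rw [_root_.SimpleGraph.fromEdgeSet_adj]
      exact ⟨by simp, hqp'⟩
    have : p :: (xs ++ q :: p' :: (ys ++ [q'])) = (p :: xs) ++ [q] ++ (p' :: (ys ++ [q'])) := by simp
    rw [this]
    exact List.IsChain.append_overlap (by simpa using hc1) hc2 (List.cons_ne_nil _ _)

/-! ### One slot: covers are Hamiltonian paths -/

/-- **The census of a single slot `(a, b)` is the number of Hamiltonian `a`–`b` paths of the gadget
through `VX ∪ {a, b}`.** [cite: GareyJohnson1979, §3.2.2] -/
theorem coverCount_singleton_eq_hamCount (hVX : VX.Nonempty) {a b : α} (ha : a ∉ VX) (hb : b ∉ VX) (hab : a ≠ b) :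
    coverCount GX VX {(a, b)} = hamCount GX (insert a (insert b VX)) a b := by
  -- the gluing map and its inverse
  set φ : (α × α → List α) → List α := fun f => a :: (f (a, b) ++ [b]) with hφ
  have hW : ∀ x, x ∈ insert a (insert b VX) ↔ x = a ∨ x = b ∨ x ∈ VX := fun x => by simp
  have hcov_of : ∀ f, IsCover GX VX {(a, b)} f → ∀ x ∈ VX, x ∈ f (a, b) := fun f hf x hx => by
    obtain ⟨e, he, hxe⟩ := hf.2.2.2 x hx
    rw [Finset.mem_singleton] at he
    exact he ▸ hxe
  have himg : φ '' coverSet GX VX {(a, b)} = hamSetRF GX (insert a (insert b VX)) a b ∅ ∅ := by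
    ext l
    simp only [Set.mem_image, mem_hamSetRF_empty]
    constructor
    · rintro ⟨f, hf, rfl⟩
      exact isHamPathOn_strand (hf.1 _ (Finset.mem_singleton_self _)) (hcov_of f hf) ha hb hab hW
    · intro hl
      -- decompose `l = a :: L ++ [b]`
      obtain ⟨hnd, hsupp, hhead, hlast, hch⟩ := hl
      obtain ⟨L, rfl⟩ := exists_eq_cons_append_of_head?_getLast? hhead hlast hab
      have hLsub : ∀ x ∈ L, x ∈ VX := fun x hx => by
        have hx' : x ∈ insert a (insert b VX) := by
          rw [← hsupp]; simp [hx]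
        rw [Finset.mem_insert, Finset.mem_insert] at hx'
        rcases hx' with h | h | h
        · subst h
          exact absurd (List.mem_append_left [b] hx) (List.nodup_cons.1 hnd).1
        · subst h
          exact absurd (List.mem_singleton_self x) (List.disjoint_of_nodup_append (List.nodup_cons.1 hnd).2 hx)
        · exact h
      have hLcov : ∀ x ∈ VX, x ∈ L := fun x hx => by
        have hx' : x ∈ a :: (L ++ [b]) := by
          rw [← List.mem_toFinset, hsupp]; simp [hx]
        simp only [List.mem_cons, List.mem_append, List.mem_nil_iff, or_false] at hx'
        rcases hx' with rfl | h | rfl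
        · exact absurd hx ha
        · exact h
        · exact absurd hx hb
      have hLne : L ≠ [] := by
        obtain ⟨x, hx⟩ := hVX
        exact List.ne_nil_of_mem (hLcov x hx)
      refine ⟨fun e => if e = (a, b) then L else [], ⟨fun e he => ?_, fun e he => ?_, ?_, fun x hx => ?_⟩, by simp [hφ]⟩
      · rw [Finset.mem_singleton] at he
        subst he
        simp only [if_true]
        exact ⟨hLne, hLsub, (List.nodup_append.1 (List.nodup_cons.1 hnd).2).1, hch⟩
      · rw [Finset.mem_singleton] at he
        simp [he]
      · intro e he e' he' hne
        rw [Finset.mem_singleton] at he he'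
        exact absurd (he.trans he'.symm) hne
      · refine ⟨(a, b), Finset.mem_singleton_self _, ?_⟩
        simp only [if_true]
        exact hLcov x hx
  have hinj : Set.InjOn φ (coverSet GX VX {(a, b)}) := by
    intro f hf f' hf' heq
    simp only [hφ, List.cons.injEq, true_and] at heq
    have hab' : f (a, b) = f' (a, b) := List.append_cancel_right heq
    funext e
    by_cases he : e = (a, b)
    · rw [he, hab']
    · rw [hf.2.1 e (by simpa using he), hf'.2.1 e (by simpa using he)]
  rw [coverCount, ← hinj.ncard_image, himg, hamCount_eq, hamCountRF]


/-! ### No slot: no cover -/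

/-- **A nonempty gadget has no cover realising no slot.** [folklore] -/
theorem coverCount_empty_eq_zero (hVX : VX.Nonempty) : coverCount GX VX (∅ : Finset (α × α)) = 0 := by
  rw [coverCount, Set.ncard_eq_zero (coverSet_finite GX VX ∅)]
  ext f
  simp only [coverSet, Set.mem_setOf_eq, Set.mem_empty_iff_false, iff_false]
  intro hf
  obtain ⟨x, hx⟩ := hVX
  obtain ⟨e, he, -⟩ := hf.2.2.2 x hx
  simp at he

/-! ### Two slots -/

section pair

variable {e f : α × α}

omit [DecidableEq α] in
/-- The ports of a two-slot gadget. [folklore] -/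
theorem mem_ports_pair [DecidableEq α] {x : α} : x ∈ ports ({e, f} : Finset (α × α)) ↔ x = e.1 ∨ x = e.2 ∨ x = f.1 ∨ x = f.2 := by
  rw [mem_ports_iff]
  constructor
  · rintro ⟨g, hg, h⟩
    rw [Finset.mem_insert, Finset.mem_singleton] at hg
    rcases hg with rfl | rfl <;> rcases h with h | h <;> simp [h]
  · rintro (h | h | h | h)
    · exact ⟨e, by simp, Or.inl h⟩
    · exact ⟨e, by simp, Or.inr h⟩
    · exact ⟨f, by simp, Or.inl h⟩
    · exact ⟨f, by simp, Or.inr h⟩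

/-- **If the connector graph `GX ⊔ edge e₂ f₁` has no Hamiltonian `e₁`–`f₂` path, no cover realises
both slots.** (A cover realising `e` and `f` consists of strands `e₁ ⇝ e₂` and `f₁ ⇝ f₂`, which
glue through the connector.) [cite: GareyJohnson1979, §3.2.2] -/
theorem coverCount_pair_eq_zero_of_hamCount_eq_zero (hef : e ≠ f)
    (he1 : e.1 ∉ VX) (he2 : e.2 ∉ VX) (hf1 : f.1 ∉ VX) (hf2 : f.2 ∉ VX)
    (h12 : e.1 ≠ e.2) (h13 : e.1 ≠ f.1) (h14 : e.1 ≠ f.2) (h23 : e.2 ≠ f.1) (h24 : e.2 ≠ f.2) (h34 : f.1 ≠ f.2)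
    {W : Finset α} (hW : ∀ x, x ∈ W ↔ x = e.1 ∨ x = e.2 ∨ x = f.1 ∨ x = f.2 ∨ x ∈ VX)
    (HA : hamCount (GX ⊔ _root_.SimpleGraph.fromEdgeSet {s(e.2, f.1)}) W e.1 f.2 = 0) :
    coverCount GX VX ({e, f} : Finset (α × α)) = 0 := by
  rw [coverCount, Set.ncard_eq_zero (coverSet_finite GX VX _)]
  ext g
  simp only [coverSet, Set.mem_setOf_eq, Set.mem_empty_iff_false, iff_false]
  intro hg
  have hse : e ∈ ({e, f} : Finset (α × α)) := by simp
  have hsf : f ∈ ({e, f} : Finset (α × α)) := by simp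
  have hxs := hg.1 e hse
  have hys := hg.1 f hsf
  have hdis : List.Disjoint (g e) (g f) := hg.2.2.1 e hse f hsf hef
  have hcov : ∀ x ∈ VX, x ∈ g e ∨ x ∈ g f := fun x hx => by
    obtain ⟨d, hd, hxd⟩ := hg.2.2.2 x hx
    rw [Finset.mem_insert, Finset.mem_singleton] at hd
    rcases hd with rfl | rfl
    · exact Or.inl hxd
    · exact Or.inr hxd
  have hpath := isHamPathOn_two_strands hxs hys hdis hcov he1 he2 hf1 hf2 h12 h13 h14 h23 h24 h34 (W := W) hW
  have := hamCount_pos_of_isHamPathOn hpath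
  omega

/-- **Exclusivity of a two-slot gadget from Hamiltonian-path counts.** If none of the four "wrong"
port pairs `eᵢ, fⱼ` is joined by a Hamiltonian path of the gadget through `VX ∪ {eᵢ, fⱼ}`, and the
two connector graphs `GX ⊔ edge e₂ f₁` (from `e₁` to `f₂`) and `GX ⊔ edge e₂ f₂` (from `e₁` to
`f₁`) have no Hamiltonian path through `VX ∪ ports`, then every family of port-to-port strands
covering the gadget joins the two ports of slots only. [cite: GareyJohnson1979, §3.2.2; LiskiewiczOgiharaToda2003, §3 (XOR-gadget: "one has to enter and exit on the same vertical axis")] -/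
theorem exclusive_pair_of_hamCount_eq_zero
    (he1 : e.1 ∉ VX) (he2 : e.2 ∉ VX) (hf1 : f.1 ∉ VX) (hf2 : f.2 ∉ VX)
    (h12 : e.1 ≠ e.2) (h13 : e.1 ≠ f.1) (h14 : e.1 ≠ f.2) (h23 : e.2 ≠ f.1) (h24 : e.2 ≠ f.2) (h34 : f.1 ≠ f.2)
    (H11 : hamCount GX (insert e.1 (insert f.1 VX)) e.1 f.1 = 0)
    (H12 : hamCount GX (insert e.1 (insert f.2 VX)) e.1 f.2 = 0)
    (H21 : hamCount GX (insert e.2 (insert f.1 VX)) e.2 f.1 = 0)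
    (H22 : hamCount GX (insert e.2 (insert f.2 VX)) e.2 f.2 = 0)
    {W : Finset α} (hW : ∀ x, x ∈ W ↔ x = e.1 ∨ x = e.2 ∨ x = f.1 ∨ x = f.2 ∨ x ∈ VX)
    (HA : hamCount (GX ⊔ _root_.SimpleGraph.fromEdgeSet {s(f.1, e.2)}) W e.1 f.2 = 0)
    (HB : hamCount (GX ⊔ _root_.SimpleGraph.fromEdgeSet {s(f.2, e.2)}) W e.1 f.1 = 0) :
    Exclusive GX VX ({e, f} : Finset (α × α)) := by
  -- one strand between a wrong pair of ports cannot cover the gadget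
  have single : ∀ (p q : α) (xs : List α), IsStrand GX VX p q xs → (∀ x ∈ VX, x ∈ xs) →
      p ∈ ports ({e, f} : Finset (α × α)) → q ∈ ports ({e, f} : Finset (α × α)) → p ≠ q →
      ¬ slotOf ({e, f} : Finset (α × α)) p q → False := by
    intro p q xs hxs hcov hp hq hpq hns
    have hse : slotOf ({e, f} : Finset (α × α)) e.1 e.2 := Or.inl (by simp)
    have hse' : slotOf ({e, f} : Finset (α × α)) e.2 e.1 := Or.inr (by simp)
    have hsf : slotOf ({e, f} : Finset (α × α)) f.1 f.2 := Or.inl (by simp)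
    have hsf' : slotOf ({e, f} : Finset (α × α)) f.2 f.1 := Or.inr (by simp)
    -- a covering strand from `u` to `v` gives a positive count
    have pos : ∀ (u v : α) (ys : List α), IsStrand GX VX u v ys → (∀ x ∈ VX, x ∈ ys) → u ∉ VX → v ∉ VX → u ≠ v →
        0 < hamCount GX (insert u (insert v VX)) u v := fun u v ys hys hc hu hv huv =>
      hamCount_pos_of_isHamPathOn (isHamPathOn_strand hys hc hu hv huv (W := insert u (insert v VX)) (by simp))
    have hcov' : ∀ x ∈ VX, x ∈ xs.reverse := fun x hx => List.mem_reverse.2 (hcov x hx)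
    rw [mem_ports_pair] at hp hq
    rcases hp with rfl | rfl | rfl | rfl <;> rcases hq with h | h | h | h <;> subst h
    · exact hpq rfl
    · exact hns hse
    · have := pos _ _ _ hxs hcov he1 hf1 h13; omega
    · have := pos _ _ _ hxs hcov he1 hf2 h14; omega
    · exact hns hse'
    · exact hpq rfl
    · have := pos _ _ _ hxs hcov he2 hf1 h23; omega
    · have := pos _ _ _ hxs hcov he2 hf2 h24; omega
    · have := pos _ _ _ hxs.reverse hcov' he1 hf1 h13; omega
    · have := pos _ _ _ hxs.reverse hcov' he2 hf1 h23; omega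
    · exact hpq rfl
    · exact hns hsf
    · have := pos _ _ _ hxs.reverse hcov' he1 hf2 h14; omega
    · have := pos _ _ _ hxs.reverse hcov' he2 hf2 h24; omega
    · exact hns hsf'
    · exact hpq rfl
  -- the two wrong pairings cannot cover the gadget (glue through a connector)
  have P1 : ∀ (L₁ L₂ : List α), IsStrand GX VX e.1 f.1 L₁ → IsStrand GX VX e.2 f.2 L₂ →
      List.Disjoint L₁ L₂ → (∀ x ∈ VX, x ∈ L₁ ∨ x ∈ L₂) → False := by
    intro L₁ L₂ h1 h2 hd hc
    have hpath := isHamPathOn_two_strands h1 h2 hd hc he1 hf1 he2 hf2 h13 h12 h14 (Ne.symm h23) h34 h24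
      (W := W) (fun x => by rw [hW]; tauto)
    have := hamCount_pos_of_isHamPathOn hpath
    omega
  have P2 : ∀ (L₁ L₂ : List α), IsStrand GX VX e.1 f.2 L₁ → IsStrand GX VX e.2 f.1 L₂ →
      List.Disjoint L₁ L₂ → (∀ x ∈ VX, x ∈ L₁ ∨ x ∈ L₂) → False := by
    intro L₁ L₂ h1 h2 hd hc
    have hpath := isHamPathOn_two_strands h1 h2 hd hc he1 hf2 he2 hf1 h14 h12 h13 (Ne.symm h24) (Ne.symm h34) h23
      (W := W) (fun x => by rw [hW]; tauto)
    have := hamCount_pos_of_isHamPathOn hpath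
    omega
  -- with orientations normalised
  have P1' : ∀ (L₁ L₂ : List α), (IsStrand GX VX e.1 f.1 L₁ ∨ IsStrand GX VX f.1 e.1 L₁) →
      (IsStrand GX VX e.2 f.2 L₂ ∨ IsStrand GX VX f.2 e.2 L₂) →
      List.Disjoint L₁ L₂ → (∀ x ∈ VX, x ∈ L₁ ∨ x ∈ L₂) → False := by
    intro L₁ L₂ h1 h2 hd hc
    rcases h1 with h1 | h1 <;> rcases h2 with h2 | h2
    · exact P1 L₁ L₂ h1 h2 hd hc
    · exact P1 L₁ L₂.reverse h1 h2.reverse (List.disjoint_reverse_right.2 hd) (fun x hx => by simpa using hc x hx)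
    · exact P1 L₁.reverse L₂ h1.reverse h2 (List.disjoint_reverse_left.2 hd) (fun x hx => by simpa using hc x hx)
    · exact P1 L₁.reverse L₂.reverse h1.reverse h2.reverse (by simpa using hd) (fun x hx => by simpa using hc x hx)
  have P2' : ∀ (L₁ L₂ : List α), (IsStrand GX VX e.1 f.2 L₁ ∨ IsStrand GX VX f.2 e.1 L₁) →
      (IsStrand GX VX e.2 f.1 L₂ ∨ IsStrand GX VX f.1 e.2 L₂) →
      List.Disjoint L₁ L₂ → (∀ x ∈ VX, x ∈ L₁ ∨ x ∈ L₂) → False := by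
    intro L₁ L₂ h1 h2 hd hc
    rcases h1 with h1 | h1 <;> rcases h2 with h2 | h2
    · exact P2 L₁ L₂ h1 h2 hd hc
    · exact P2 L₁ L₂.reverse h1 h2.reverse (List.disjoint_reverse_right.2 hd) (fun x hx => by simpa using hc x hx)
    · exact P2 L₁.reverse L₂ h1.reverse h2 (List.disjoint_reverse_left.2 hd) (fun x hx => by simpa using hc x hx)
    · exact P2 L₁.reverse L₂.reverse h1.reverse h2.reverse (by simpa using hd) (fun x hx => by simpa using hc x hx)
  -- two strands with endpoints the four ports, the first between a wrong pair, cannot cover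
  have pair : ∀ (a₁ b₁ a₂ b₂ : α) (L₁ L₂ : List α), IsStrand GX VX a₁ b₁ L₁ → IsStrand GX VX a₂ b₂ L₂ →
      List.Disjoint L₁ L₂ → (∀ x ∈ VX, x ∈ L₁ ∨ x ∈ L₂) →
      a₁ ∈ ports ({e, f} : Finset (α × α)) → b₁ ∈ ports ({e, f} : Finset (α × α)) →
      a₂ ∈ ports ({e, f} : Finset (α × α)) → b₂ ∈ ports ({e, f} : Finset (α × α)) →
      a₁ ≠ b₁ → a₁ ≠ a₂ → a₁ ≠ b₂ → b₁ ≠ a₂ → b₁ ≠ b₂ → a₂ ≠ b₂ →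
      ¬ slotOf ({e, f} : Finset (α × α)) a₁ b₁ → False := by
    intro a₁ b₁ a₂ b₂ L₁ L₂ h1 h2 hd hc ha₁ hb₁ ha₂ hb₂ n11 n12 n13 n21 n22 n33 hns
    have hse : slotOf ({e, f} : Finset (α × α)) e.1 e.2 := Or.inl (by simp)
    have hse' : slotOf ({e, f} : Finset (α × α)) e.2 e.1 := Or.inr (by simp)
    have hsf : slotOf ({e, f} : Finset (α × α)) f.1 f.2 := Or.inl (by simp)
    have hsf' : slotOf ({e, f} : Finset (α × α)) f.2 f.1 := Or.inr (by simp)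
    have hd' : List.Disjoint L₂ L₁ := hd.symm
    have hc' : ∀ x ∈ VX, x ∈ L₂ ∨ x ∈ L₁ := fun x hx => (hc x hx).symm
    rw [mem_ports_pair] at ha₁ hb₁ ha₂ hb₂
    -- `a₁, b₁` is a wrong pair: `{a₁, b₁} = {eᵢ, fⱼ}`; then `{a₂, b₂}` is the complementary wrong pair
    rcases ha₁ with rfl | rfl | rfl | rfl <;> rcases hb₁ with h | h | h | h <;> subst h
    · exact n11 rfl
    · exact hns hse
    · -- `e.1 f.1`; the other strand joins `e.2, f.2`
      rcases ha₂ with rfl | rfl | rfl | rfl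
      · exact n12 rfl
      · rcases hb₂ with h | h | h | h <;> subst h
        · exact n13 rfl
        · exact n33 rfl
        · exact n22 rfl
        · exact P1' L₁ L₂ (Or.inl h1) (Or.inl h2) hd hc
      · exact n21 rfl
      · rcases hb₂ with h | h | h | h <;> subst h
        · exact n13 rfl
        · exact P1' L₁ L₂ (Or.inl h1) (Or.inr h2) hd hc
        · exact n22 rfl
        · exact n33 rfl
    · -- `e.1 f.2`; the other strand joins `e.2, f.1`
      rcases ha₂ with rfl | rfl | rfl | rfl
      · exact n12 rfl
      · rcases hb₂ with h | h | h | h <;> subst h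
        · exact n13 rfl
        · exact n33 rfl
        · exact P2' L₁ L₂ (Or.inl h1) (Or.inl h2) hd hc
        · exact n22 rfl
      · rcases hb₂ with h | h | h | h <;> subst h
        · exact n13 rfl
        · exact P2' L₁ L₂ (Or.inl h1) (Or.inr h2) hd hc
        · exact n33 rfl
        · exact n22 rfl
      · exact n21 rfl
    · exact hns hse'
    · exact n11 rfl
    · -- `e.2 f.1`: second strand of `P2`; the other joins `e.1, f.2`
      rcases ha₂ with rfl | rfl | rfl | rfl
      · rcases hb₂ with h | h | h | h <;> subst h
        · exact n33 rfl
        · exact n13 rfl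
        · exact n22 rfl
        · exact P2' L₂ L₁ (Or.inl h2) (Or.inl h1) hd' hc'
      · exact n12 rfl
      · exact n21 rfl
      · rcases hb₂ with h | h | h | h <;> subst h
        · exact P2' L₂ L₁ (Or.inr h2) (Or.inl h1) hd' hc'
        · exact n13 rfl
        · exact n22 rfl
        · exact n33 rfl
    · -- `e.2 f.2`: second strand of `P1`; the other joins `e.1, f.1`
      rcases ha₂ with rfl | rfl | rfl | rfl
      · rcases hb₂ with h | h | h | h <;> subst h
        · exact n33 rfl
        · exact n13 rfl
        · exact P1' L₂ L₁ (Or.inl h2) (Or.inl h1) hd' hc'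
        · exact n22 rfl
      · exact n12 rfl
      · rcases hb₂ with h | h | h | h <;> subst h
        · exact P1' L₂ L₁ (Or.inr h2) (Or.inl h1) hd' hc'
        · exact n13 rfl
        · exact n33 rfl
        · exact n22 rfl
      · exact n21 rfl
    · -- `f.1 e.1` (reversed first strand of `P1`)
      rcases ha₂ with rfl | rfl | rfl | rfl
      · exact n21 rfl
      · rcases hb₂ with h | h | h | h <;> subst h
        · exact n22 rfl
        · exact n33 rfl
        · exact n13 rfl
        · exact P1' L₁ L₂ (Or.inr h1) (Or.inl h2) hd hc
      · exact n12 rfl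
      · rcases hb₂ with h | h | h | h <;> subst h
        · exact n22 rfl
        · exact P1' L₁ L₂ (Or.inr h1) (Or.inr h2) hd hc
        · exact n13 rfl
        · exact n33 rfl
    · -- `f.1 e.2` (reversed second strand of `P2`)
      rcases ha₂ with rfl | rfl | rfl | rfl
      · rcases hb₂ with h | h | h | h <;> subst h
        · exact n33 rfl
        · exact n22 rfl
        · exact n13 rfl
        · exact P2' L₂ L₁ (Or.inl h2) (Or.inr h1) hd' hc'
      · exact n21 rfl
      · exact n12 rfl
      · rcases hb₂ with h | h | h | h <;> subst h
        · exact P2' L₂ L₁ (Or.inr h2) (Or.inr h1) hd' hc'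
        · exact n22 rfl
        · exact n13 rfl
        · exact n33 rfl
    · exact n11 rfl
    · exact hns hsf
    · -- `f.2 e.1` (reversed first strand of `P2`)
      rcases ha₂ with rfl | rfl | rfl | rfl
      · exact n21 rfl
      · rcases hb₂ with h | h | h | h <;> subst h
        · exact n22 rfl
        · exact n33 rfl
        · exact P2' L₁ L₂ (Or.inr h1) (Or.inl h2) hd hc
        · exact n13 rfl
      · rcases hb₂ with h | h | h | h <;> subst h
        · exact n22 rfl
        · exact P2' L₁ L₂ (Or.inr h1) (Or.inr h2) hd hc
        · exact n33 rfl
        · exact n13 rfl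
      · exact n12 rfl
    · -- `f.2 e.2` (reversed second strand of `P1`)
      rcases ha₂ with rfl | rfl | rfl | rfl
      · rcases hb₂ with h | h | h | h <;> subst h
        · exact n33 rfl
        · exact n22 rfl
        · exact P1' L₂ L₁ (Or.inl h2) (Or.inr h1) hd' hc'
        · exact n13 rfl
      · exact n21 rfl
      · rcases hb₂ with h | h | h | h <;> subst h
        · exact P1' L₂ L₁ (Or.inr h2) (Or.inr h1) hd' hc'
        · exact n22 rfl
        · exact n33 rfl
        · exact n13 rfl
      · exact n12 rfl
    · exact hns hsf'
    · exact n11 rfl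
  -- the strand family
  intro T hT1 hT2 hT3 hT4 τ hτ
  by_contra hns
  by_cases hex : ∃ τ' ∈ T, τ' ≠ τ
  · obtain ⟨τ', hτ', hne⟩ := hex
    obtain ⟨d1, d2, d3, d4, hdis⟩ := hT2 τ hτ τ' hτ' (Ne.symm hne)
    -- every strand of the family is `τ` or `τ'`: its first port is one of the four distinct ports
    have hfour : ∀ y ∈ ports ({e, f} : Finset (α × α)), y = τ.1 ∨ y = τ.2.2 ∨ y = τ'.1 ∨ y = τ'.2.2 := by
      intro y hy
      have hP : ports ({e, f} : Finset (α × α)) ⊆ {e.1, e.2, f.1, f.2} := fun z hz => by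
        simpa [Finset.mem_insert, Finset.mem_singleton] using (mem_ports_pair.1 hz)
      have hQ : ({τ.1, τ.2.2, τ'.1, τ'.2.2} : Finset α) ⊆ ports ({e, f} : Finset (α × α)) := by
        intro z hz
        simp only [Finset.mem_insert, Finset.mem_singleton] at hz
        rcases hz with rfl | rfl | rfl | rfl
        exacts [(hT1 τ hτ).1, (hT1 τ hτ).2.1, (hT1 τ' hτ').1, (hT1 τ' hτ').2.1]
      have hcard4 : ({τ.1, τ.2.2, τ'.1, τ'.2.2} : Finset α).card = 4 := by
        have h0 := hT3 τ hτ
        have h0' := hT3 τ' hτ'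
        rw [Finset.card_insert_of_notMem (by simp [h0, d1, d2]), Finset.card_insert_of_notMem (by simp [d3, d4]),
          Finset.card_insert_of_notMem (by simp [h0']), Finset.card_singleton]
      have hcardP : (ports ({e, f} : Finset (α × α))).card ≤ 4 :=
        (Finset.card_le_card hP).trans (Finset.card_le_four)
      have heq : ({τ.1, τ.2.2, τ'.1, τ'.2.2} : Finset α) = ports ({e, f} : Finset (α × α)) :=
        Finset.eq_of_subset_of_card_le hQ (by omega)
      have : y ∈ ({τ.1, τ.2.2, τ'.1, τ'.2.2} : Finset α) := heq ▸ hy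
      simpa [Finset.mem_insert, Finset.mem_singleton] using this
    have honly : ∀ τ'' ∈ T, τ'' = τ ∨ τ'' = τ' := by
      intro τ'' hτ''
      by_contra hc
      obtain ⟨hc1, hc2⟩ := not_or.1 hc
      obtain ⟨a1, -, a3, -, -⟩ := hT2 τ hτ τ'' hτ'' (Ne.symm hc1)
      obtain ⟨b1, -, b3, -, -⟩ := hT2 τ' hτ' τ'' hτ'' (Ne.symm hc2)
      rcases hfour τ''.1 (hT1 τ'' hτ'').1 with h | h | h | h
      · exact a1 h.symm
      · exact a3 h.symm
      · exact b1 h.symm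
      · exact b3 h.symm
    have hcov : ∀ x ∈ VX, x ∈ τ.2.1 ∨ x ∈ τ'.2.1 := by
      intro x hx
      obtain ⟨τ'', hτ'', hx''⟩ := hT4 x hx
      rcases honly τ'' hτ'' with rfl | rfl
      · exact Or.inl hx''
      · exact Or.inr hx''
    exact pair τ.1 τ.2.2 τ'.1 τ'.2.2 τ.2.1 τ'.2.1 (hT1 τ hτ).2.2 (hT1 τ' hτ').2.2 hdis hcov
      (hT1 τ hτ).1 (hT1 τ hτ).2.1 (hT1 τ' hτ').1 (hT1 τ' hτ').2.1 (hT3 τ hτ) d1 d2 d3 d4 (hT3 τ' hτ') hns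
  · have hex' : ∀ τ'' ∈ T, τ'' = τ := fun τ'' h'' => by
      by_contra hc; exact hex ⟨τ'', h'', hc⟩
    have hcov : ∀ x ∈ VX, x ∈ τ.2.1 := by
      intro x hx
      obtain ⟨τ'', hτ'', hx''⟩ := hT4 x hx
      rw [hex' τ'' hτ''] at hx''
      exact hx''
    exact single τ.1 τ.2.2 τ.2.1 (hT1 τ hτ).2.2 hcov (hT1 τ hτ).1 (hT1 τ hτ).2.1 (hT3 τ hτ) hns

end pair

end Literature.Combinatorics.SimpleGraph
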